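import Mathlib
import HarnessLib
import Literature.Computability.AlgebraicComplexity.NilCoxeterTensor
import Literature.Computability.AlgebraicComplexity.BorderRankMatMulSmallProofs
import Literature.Computability.AlgebraicComplexity.StrassenMinimalBorderRank
import Literature.Computability.AlgebraicComplexity.SchoenhageTauBini

/-!
# `bR(T_{NC_3}) ≤ 8`: the nil-Coxeter tensor of `S_3` through the 0-Hecke algebra `H_3(0)` (kernel-checked certificate)

Support file for crux `AThesis` (stmt-MatrixMultiplication-0956) of route `NilCoxeterShadow`
(`b n := bR(T_{NC_n}) = algBorderRank (nilCoxeterTensor K n)`, border rank over `K[ε]`, Bläser 2013 Def. 6.1).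

The route's kill criterion ("`b n / n!` ↘ 1") and the calibration of the crux (cycle 2: given `ω ≠ 2` the whole
open content of `AThesis` is whether the Rees degeneration `K[S_n] ⇝ NC_n = gr K[S_n]` loses border rank) both ask
for UPPER bounds on `b n` that do not route through the Wedderburn blocks of `K[S_n]`. This file proves the first
one: **`bR(T_{NC_3}) ≤ 8`** over every commutative ring, strictly below `R(T_{K[S_3]}) = 9`
(`K[S_3] ≅ K ⊕ K ⊕ M_2(K)`, `1 + 1 + 7`; Alder–Strassen `2·6 − 3`), by an explicit order-`3` approximate
decomposition with `8` triads whose entries are signed monomials `±ε^k`.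

Where the eight triads come from (informal provenance; the kernel check below IS the proof). The 0-Hecke
algebra `H_3(0)` (Norton 1979) — the monoid algebra of the 0-Hecke monoid `(S_3, ∘)` (Demazure product,
`π_s ∘ w = sw` if `ℓ(sw) > ℓ(w)`, else `w`) — splits as `K π_{w₀} ⊕ K f ⊕ N` with the central idempotents
`π_{w₀}` and `f = ∑_w (−1)^{ℓ(w)} π_w`, and `N` the radical-square-zero Nakayama algebra of the 2-cycle quiver
(`e_a = π₁ − π₁₂`, `e_b = π₂ − π₂₁`, arrows `π₁₂`, `π₂₁`), whose multiplication
`(ξ_a, ξ_b, ξ_α, ξ_β)·(η_a, η_b, η_α, η_β) = (ξ_aη_a, ξ_bη_b, ξ_aη_α + ξ_αη_b, ξ_bη_β + ξ_βη_a)` needs `6` products;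
so `R(T_{H_3(0)}) ≤ 1 + 1 + 6 = 8` (optimal: Alder–Strassen gives `2·6 − 4 = 8`). Along the one-parameter family
`T_w ↦ ε^{ℓ(w)} π_w` the relations `π_s² = π_s` become `T_s² = ε T_s → 0`: `H_3(0)` degenerates to `NC_3`
(Humphreys' generic algebra `𝓔(a, 0)`, `a → 0`), and the Rees twist `u(z) ↦ ε^{3−ℓ(z)} u(z)`,
`v(x) ↦ ε^{ℓ(x)} v(x)`, `w(y) ↦ ε^{ℓ(y)} w(y)` of the rank-`8` decomposition is an order-`3` approximate
decomposition of `T_{NC_3}`, because `ℓ(x ∘ y) ≤ ℓ(x) + ℓ(y)` with equality exactly when `x·y` is reduced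
(and then `x ∘ y = xy`). With the lower bound `7 ≤ bR(T_{NC_3})` (non-commutative unital algebras are not of
minimal border rank, Bläser–Lysikov 2016) this leaves `bR(T_{NC_3}) ∈ {7, 8}`.

## Contents (all proved; no definitions, no named facts)

* `exists_isApproxDecomposition_three_nilCoxeterTensor_three` — the certificate: `8` triads
  `Fin 8 → Equiv.Perm (Fin 3) → K[X]` with `IsApproxDecomposition 3 (nilCoxeterTensor K 3)`; the integer
  coefficient tables (keyed by `(w 0, w 1)`, which determines `w ∈ S_3`) live inside the proof, the
  `6·6·6` entries in degrees `0, …, 3` are compared with `ε³ · T_{NC_3}` by the kernel (`decide`), and the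
  integer-polynomial toolkit `Smirnov2013.toPoly/pmul/psum/coeffL` of `BorderRankMatMulSmallProofs.lean`
  transports the check to `K[X]`.
* `approxRank_three_nilCoxeterTensor_three_le` (`R₃(T_{NC_3}) ≤ 8`) and
  `algBorderRank_nilCoxeterTensor_three_le` (**`bR(T_{NC_3}) ≤ 8`**), every commutative ring.

## References

* [Norton1979] P. N. Norton, *0-Hecke algebras*, J. Austral. Math. Soc. Ser. A 27 (1979) 337–357 — structure
  of `H_n(0)` (simples, projectives); here only the case `n = 3`, recomputed by hand.
* [Humphreys1990] J. E. Humphreys, *Reflection Groups and Coxeter Groups*, CUP 1990, §7.1 (generic algebras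
  `𝓔(a_s, b_s)`; `a_s = b_s = 0` is `NC_n`, `b_s = 0` is `H_n(0)` up to scaling).
* [BlaserLysikov2016] M. Bläser, V. Lysikov, *On degeneration of tensors and algebras*, MFCS 2016,
  arXiv:1606.04253, §2.2–2.3 and Lemma 4 (one-parameter families of basis changes give degenerations;
  `bR(φ) ≤ r ⇔ φ ⊴ ⟨r⟩`).
* [Blaser2013] M. Bläser, *Fast Matrix Multiplication*, Theory of Computing Graduate Surveys 5 (2013), Def. 6.1;
  [AlderStrassen1981] A. Alder, V. Strassen, Theoret. Comput. Sci. 15 (1981) 201–211 (`R(A) ≥ 2 dim A − t`).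
-/

-- `Summit.<Summit>.<Problem>`: for the single-conjunct summit the duplicate component is mandated.
set_option linter.dupNamespace false

noncomputable section

open scoped BigOperators Polynomial Matrix
open Polynomial Matrix

namespace Summit.MatrixMultiplication.MatrixMultiplication.Theorems.AThesis

open Literature.Computability.AlgebraicComplexity
open Literature.Computability.AlgebraicComplexity.Smirnov2013

/-- **The certificate: an order-`3` approximate decomposition of `T_{NC_3}` with `8` triads**, over every
commutative ring `K`: `∑_{t<8} u_t ⊗ v_t ⊗ w_t = ε³ · T_{NC_3} + O(ε⁴)` in `K[ε]^{S_3} ⊗ K[ε]^{S_3} ⊗ K[ε]^{S_3}`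
(slots `(z, x, y)` = output, left factor, right factor, as `nilCoxeterTensor`). The vectors are the Rees twist
(`ε^{3−ℓ(z)}`, `ε^{ℓ(x)}`, `ε^{ℓ(y)}`) of the eight products `ξ_{w₀}η_{w₀}`, `ξ_fη_f`, `ξ_aη_a`, `ξ_bη_b`,
`ξ_aη_α`, `ξ_αη_b`, `ξ_bη_β`, `ξ_βη_a` computing the multiplication of the 0-Hecke algebra
`H_3(0) ≅ K ⊕ K ⊕ N` in the coordinates `ξ_f = X_e`, `ξ_a = X_e + X_{s₁}`, `ξ_b = X_e + X_{s₂}`,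
`ξ_α = X_{s₁} + X_{s₁s₂}`, `ξ_β = X_{s₂} + X_{s₂s₁}`, `ξ_{w₀} = ∑_w X_w` (see the file header). The integer
coefficient tables are keyed by `(w 0, w 1)`; all `216` entries in degrees `≤ 3` are checked by the kernel.
[cite: BlaserLysikov2016, §2.3 and Lemma 4] [cite: Blaser2013, Def. 6.1] -/
theorem exists_isApproxDecomposition_three_nilCoxeterTensor_three (K : Type*) [CommRing K] :
    ∃ (u v w : Fin 8 → Equiv.Perm (Fin 3) → K[X]),
      IsApproxDecomposition 3 (nilCoxeterTensor K 3) u v w := by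
  -- output slot `z`: `ε^{3-ℓ(z)} ·` (coefficient of `T_z` in the `t`-th product), keyed by `(z 0, z 1)`
  let U : Fin 8 → Fin 3 → Fin 3 → List ℤ :=
    ![![![[], [], []], ![[], [], []], ![[], [1], []]],
      ![![[], [0,0,0,1], [0,0,-1]], ![[0,0,-1], [], [0,1]], ![[0,1], [-1], []]],
      ![![[], [], []], ![[0,0,1], [], [0,-1]], ![[], [], []]],
      ![![[], [], [0,0,1]], ![[], [], []], ![[0,-1], [], []]],
      ![![[], [], []], ![[], [], [0,1]], ![[], [-1], []]],
      ![![[], [], []], ![[], [], [0,1]], ![[], [-1], []]],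
      ![![[], [], []], ![[], [], []], ![[0,1], [-1], []]],
      ![![[], [], []], ![[], [], []], ![[0,1], [-1], []]]]
  -- left factor `x`: `ε^{ℓ(x)} ·` (left linear form of the `t`-th product), keyed by `(x 0, x 1)`
  let V : Fin 8 → Fin 3 → Fin 3 → List ℤ :=
    ![![![[], [1], [0,1]], ![[0,1], [], [0,0,1]], ![[0,0,1], [0,0,0,1], []]],
      ![![[], [1], []], ![[], [], []], ![[], [], []]],
      ![![[], [1], []], ![[0,1], [], []], ![[], [], []]],
      ![![[], [1], [0,1]], ![[], [], []], ![[], [], []]],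
      ![![[], [1], []], ![[0,1], [], []], ![[], [], []]],
      ![![[], [], []], ![[0,1], [], [0,0,1]], ![[], [], []]],
      ![![[], [1], [0,1]], ![[], [], []], ![[], [], []]],
      ![![[], [], [0,1]], ![[], [], []], ![[0,0,1], [], []]]]
  -- right factor `y`: `ε^{ℓ(y)} ·` (right linear form of the `t`-th product), keyed by `(y 0, y 1)`
  let W : Fin 8 → Fin 3 → Fin 3 → List ℤ :=
    ![![![[], [1], [0,1]], ![[0,1], [], [0,0,1]], ![[0,0,1], [0,0,0,1], []]],
      ![![[], [1], []], ![[], [], []], ![[], [], []]],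
      ![![[], [1], []], ![[0,1], [], []], ![[], [], []]],
      ![![[], [1], [0,1]], ![[], [], []], ![[], [], []]],
      ![![[], [], []], ![[0,1], [], [0,0,1]], ![[], [], []]],
      ![![[], [1], [0,1]], ![[], [], []], ![[], [], []]],
      ![![[], [], [0,1]], ![[], [], []], ![[0,0,1], [], []]],
      ![![[], [1], []], ![[0,1], [], []], ![[], [], []]]]
  -- the finite check, run by the kernel: every entry, every degree `≤ 3`
  have hcheck : ∀ z x y : Equiv.Perm (Fin 3), ∀ d ∈ List.range 4,
      coeffL (psum (List.ofFn fun t : Fin 8 =>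
        pmul (pmul (U t (z 0) (z 1)) (V t (x 0) (x 1))) (W t (y 0) (y 1)))) d =
        (if d = 3 then
          (if x * y = z ∧ inversionNumber z = inversionNumber x + inversionNumber y then 1 else 0)
         else 0) := by
    decide
  refine ⟨fun t z => toPoly (U t (z 0) (z 1)), fun t x => toPoly (V t (x 0) (x 1)),
    fun t y => toPoly (W t (y 0) (y 1)), ?_⟩
  intro z x y d hd
  have hsum : (∑ t : Fin 8, (toPoly (U t (z 0) (z 1)) : K[X]) * toPoly (V t (x 0) (x 1)) *
      toPoly (W t (y 0) (y 1))) = toPoly (psum (List.ofFn fun t : Fin 8 =>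
        pmul (pmul (U t (z 0) (z 1)) (V t (x 0) (x 1))) (W t (y 0) (y 1)))) := by
    rw [toPoly_psum, List.map_ofFn, List.sum_ofFn]
    refine Finset.sum_congr rfl fun t _ => ?_
    simp only [Function.comp_apply, toPoly_pmul]
  rw [hsum, coeff_toPoly, hcheck z x y d (List.mem_range.2 (by omega)), nilCoxeterTensor_apply]
  split_ifs <;> simp

/-- **`R₃(T_{NC_3}) ≤ 8`**: the order-`3` approximate rank of the nil-Coxeter tensor of `S_3` is at most `8`,
over every commutative ring. [cite: Blaser2013, Def. 6.1] -/
theorem approxRank_three_nilCoxeterTensor_three_le (K : Type*) [CommRing K] :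
    approxRank 3 (nilCoxeterTensor K 3) ≤ 8 := by
  obtain ⟨u, v, w, h⟩ := exists_isApproxDecomposition_three_nilCoxeterTensor_three K
  exact approxRank_le_of_isApproxDecomposition h

/-- **`bR(T_{NC_3}) ≤ 8`** over every commutative ring (in particular over `ℂ`, the route's `b 3 ≤ 8`):
the nil-Coxeter tensor of `S_3` has border rank at most `8 = R(T_{H_3(0)})`, one less than
`R(T_{K[S_3]}) = 9`; with `bR ≥ 7` (Bläser–Lysikov) the value is `7` or `8`.
[cite: BlaserLysikov2016, §2.3 and Lemma 4] [cite: Blaser2013, Def. 6.1] -/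
theorem algBorderRank_nilCoxeterTensor_three_le (K : Type*) [CommRing K] :
    algBorderRank (nilCoxeterTensor K 3) ≤ 8 :=
  (algBorderRank_le_approxRank 3 _).trans (approxRank_three_nilCoxeterTensor_three_le K)

/-! ## The lower bound `7 ≤ bR(T_{NC_3})`: Strassen's equations (non-commutativity of `NC_3`) -/

section LowerBound

variable (K : Type*) [CommRing K] [IsDomain K]

/-- **Strassen's equations exclude minimal border rank for `T_{NC_3}`**: over a domain `K`, no order-`h`
approximate decomposition of `nilCoxeterTensor K 3` has exactly `6 = dim NC_3` triads. Rotate the slots to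
`(x; y, z)` and transport to `Fin 6` (the six permutations `e`, `e 0 = 1`, `e 4 = s₂s₁`); the slices are the
transposed left multiplications `L_xᵀ`, with `L_1 = 1`, so Strassen's identity
`L(p) adj L(1) L(p'') = L(p'') adj L(1) L(p)` (tree: `slice_mul_adjugate_mul_comm_of_isApproxDecomposition`)
would force `L_{s₁}ᵀ L_{s₂}ᵀ = L_{s₂}ᵀ L_{s₁}ᵀ`; but the entry `(1, s₂s₁)` is `[s₂s₁ = s₂s₁] = 1` on the left and
`[s₂s₁ = s₁s₂] = 0` on the right (integer computation by `decide`, cast to `K`). This is the `n = 3` case of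
"a non-commutative unital algebra is not of minimal border rank" (Bläser–Lysikov 2016).
[cite: Landsberg2017, Prop. 2.2.1.3 and §2.4.1] [cite: BlaserLysikov2016, §2.2–2.3] -/
theorem not_isApproxDecomposition_six_nilCoxeterTensor_three {h : ℕ}
    {u v w : Fin 6 → Equiv.Perm (Fin 3) → K[X]}
    (hd : IsApproxDecomposition h (nilCoxeterTensor K 3) u v w) : False := by
  -- the six permutations of `Fin 3`
  let e : Fin 6 → Equiv.Perm (Fin 3) := ![1, Equiv.swap 0 1, Equiv.swap 1 2,
      Equiv.swap 0 1 * Equiv.swap 1 2, Equiv.swap 1 2 * Equiv.swap 0 1,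
      Equiv.swap 0 1 * Equiv.swap 1 2 * Equiv.swap 0 1]
  -- rotate to `(x; y, z)` and relabel the two matrix slots by `e`
  have hd' := (isApproxDecomposition_rotate hd).precomp id e e
  have hS := slice_mul_adjugate_mul_comm_of_isApproxDecomposition hd' (Equiv.swap 0 1) 1 (Equiv.swap 1 2)
  -- the slices are integer matrices cast to `K`
  let tZ : Equiv.Perm (Fin 3) → Fin 6 → Fin 6 → ℤ := fun x i j => nilCoxeterTensor ℤ 3 (e j) x (e i)
  have hmap : ∀ x : Equiv.Perm (Fin 3),
      Matrix.of ((fun a b c => rotate (nilCoxeterTensor K 3) (id a) (e b) (e c)) x) =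
        (Int.castRingHom K).mapMatrix (Matrix.of (tZ x)) := by
    intro x
    ext i j
    simp only [Matrix.of_apply, rotate_apply, RingHom.mapMatrix_apply, Matrix.map_apply,
      nilCoxeterTensor_apply, id, tZ]
    split_ifs <;> simp
  have hone : Matrix.of (tZ 1) = (1 : Matrix (Fin 6) (Fin 6) ℤ) := by decide
  have hL : (Matrix.of (tZ (Equiv.swap 0 1)) * Matrix.of (tZ (Equiv.swap 1 2))) 0 4 = 1 := by decide
  have hR : (Matrix.of (tZ (Equiv.swap 1 2)) * Matrix.of (tZ (Equiv.swap 0 1))) 0 4 = 0 := by decide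
  rw [hmap, hmap, hmap, hone, map_one, adjugate_one, mul_one, mul_one] at hS
  have h2 : (Int.castRingHom K).mapMatrix (Matrix.of (tZ (Equiv.swap 0 1)) * Matrix.of (tZ (Equiv.swap 1 2))) =
      (Int.castRingHom K).mapMatrix (Matrix.of (tZ (Equiv.swap 1 2)) * Matrix.of (tZ (Equiv.swap 0 1))) := by
    rw [map_mul, map_mul]
    exact hS
  have h04 := congrFun (congrFun h2 0) 4
  rw [RingHom.mapMatrix_apply, RingHom.mapMatrix_apply, Matrix.map_apply, Matrix.map_apply, hL, hR,
    eq_intCast, eq_intCast, Int.cast_one, Int.cast_zero] at h04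
  exact one_ne_zero h04

/-- **`R_h(T_{NC_3}) ≥ 7` for every order `h`** (`K` a domain): a decomposition with `≤ 6` triads, padded
to exactly `6`, would contradict `not_isApproxDecomposition_six_nilCoxeterTensor_three`.
[cite: BlaserLysikov2016, §2.2–2.3] -/
theorem seven_le_approxRank_nilCoxeterTensor_three (h : ℕ) :
    7 ≤ approxRank h (nilCoxeterTensor K 3) := by
  by_contra hlt
  have hle : approxRank h (nilCoxeterTensor K 3) ≤ 6 := by omega
  obtain ⟨u, v, w, hd⟩ := exists_isApproxDecomposition_of_approxRank_le hle
  exact not_isApproxDecomposition_six_nilCoxeterTensor_three K hd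

/-- **`7 ≤ bR(T_{NC_3})`** over every domain `K` (in particular `ℂ`): the nil-Coxeter algebra `NC_3` is
unital and non-commutative, hence not of minimal border rank `6 = 3!` — one more than the flattening floor
`3! ≤ bR(T_{NC_3})` already in the tree (`stub_flatteningFloor`). [cite: BlaserLysikov2016, §2.2–2.3]
[cite: Landsberg2017, Prop. 2.2.1.3] -/
theorem seven_le_algBorderRank_nilCoxeterTensor_three :
    7 ≤ algBorderRank (nilCoxeterTensor K 3) :=
  le_ciInf fun h => seven_le_approxRank_nilCoxeterTensor_three K h

end LowerBound

/-- **The window `bR(T_{NC_3}) ∈ {7, 8}`** over every domain: `7 ≤ bR(T_{NC_3}) ≤ 8`. The exact value is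
open here (Koszul flattenings certify `7` and are blind beyond; `8 = R(T_{H_3(0)})`). Registered side stub of
the crux item (signature verbatim). [cite: BlaserLysikov2016, §2.2–2.3] [cite: Blaser2013, Def. 6.1] -/
theorem algBorderRank_nilCoxeterTensor_three_mem_Icc : ∀ (K : Type*) [CommRing K] [IsDomain K], Literature.Computability.AlgebraicComplexity.algBorderRank (Literature.Computability.AlgebraicComplexity.nilCoxeterTensor K 3) ∈ Set.Icc 7 8 :=
  fun K _ _ => ⟨seven_le_algBorderRank_nilCoxeterTensor_three K, algBorderRank_nilCoxeterTensor_three_le K⟩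

end Summit.MatrixMultiplication.MatrixMultiplication.Theorems.AThesis

end
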